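import Summits.ValiantsHypothesis.ValiantsHypothesis.Theorems.KPlusLogSqLawTridiagonalRealStaticUnitKernelVector
import Summits.ValiantsHypothesis.ValiantsHypothesis.Theorems.LacunarySymmetroidMatrixDescartesCensusSecularRolle

/-!
# Route «KPlusLogSqLaw», crux `WeakLifting` (stmt-ValiantsHypothesis-19561) — REAL side of the tridiagonal sector:
# the UNIT-COEFFICIENT sub-sector, ALL SIZES — the WRONSKIAN IDENTITY and the DERIVATIVE-SIGN LAW at determinant zeros

HONEST FRAMING.  Helper theorems (`--supports stmt-ValiantsHypothesis-19561 --as helper`), seat val-sym-lift-p1 (g18), cell `pub-symmetroid`,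
2026-08-28; closes the loop of `…UnitEntropyBalance` (p632571), `…UnitCrossingDirection` (p633123), `…UnitKernelVector` (p633729): the
crossing-direction law becomes a statement about the DERIVATIVE of the determinant polynomial itself (the Jacobi-formula step of the seat memo,
here proved WITHOUT matrices by an Abel–Wronskian induction on the continuant recurrence).  Currency `StaticTridiagonalRealPotential.pathDet
(fun _ => 1) d (fun _ => 1) f` (`D_k`), `F_k = f_0 + ⋯ + f_{k−1}`, energies `e_k = D_kD_{k+1}x^{−2F_k}`, masses `μ_i = x^{d_i}D_i²x^{−2F_i}`.
Proved here, for all sizes and all exponents: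
* `x_mul_eval_derivative_add_two` — the differentiated recurrence (with conjb-1's `SecularRolle.mul_natCast_mul_pow_pred`) `x·D'_{n+2} = d_{n+1}x^{d_{n+1}}D_{n+1} + x^{d_{n+1}}·xD'_{n+1} − 2f_n x^{2f_n}D_n − x^{2f_n}·xD'_n`;
* **WRONSKIAN IDENTITY** (`wronskian_eq`): `x·(D_n·D'_{n+1} − D'_n·D_{n+1}) / x^{2F_n} = Σ_{i≤n} d_i μ_i − 2Σ_{k<n} f_k e_k` for every `n` and `x > 0`;
* **JACOBI STEP** (`deriv_mul_prev_eq_neg_slopeEnergy`): at a zero `x` of `D_m` (`m = n+2`), `x·D_{m−1}(x)·D'_m(x)/x^{2F_{m−1}} = −Σ_k (2f_k − d_k − d_{k+1})·e_k`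
  — the slope-weighted energy of p633123 IS (minus) the normalised product `D_{m−1}·D'_m`;
* **DERIVATIVE-SIGN LAW** (`deriv_mul_prev_neg_below_one`, `…_pos_above_one`, `…_of_le_eight`): on the recessive side of a one-signed unit design
  (all slopes positive and `x < 1`, or all negative and `x > 1`), at every nondegenerate zero without the `N J A N` pivot pattern — and at EVERY
  nondegenerate zero when `m ≤ 8` — `D'_m(x)·D_{m−1}(x) < 0` below `1`, resp. `> 0` above `1`; in particular every such zero is SIMPLE
  (`D'_m(x) ≠ 0`): an «anti-Sturm» sign rule (for orthogonal-polynomial-type Sturm sequences `p'_m p_{m−1} > 0` at zeros).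
LOCATED (memo CROSSING-DIRECTION-liftp1g18.md §3): the rule fails without the separation hypothesis from `m = 9` on (explicit integer design
with five zeros in `(0,1)`).  Nothing here is an upper law for the register (α NO MOVER); nothing bears on `WeakLifting` / `TropicalB` (stmt-19771)
in their windows, Conjecture B, the Door-A registers, `MatrixDescartes` (stmt-18050) or VP ≠ VNP.
[this seat; folklore: Abel's identity for three-term recurrences, Jacobi's formula]
-/

-- `Summit.ValiantsHypothesis.ValiantsHypothesis.…` repeats a component by the D-0017 layout (single-conjunct summit); the name is mandated.
set_option linter.dupNamespace false
set_option autoImplicit false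

namespace Summit.ValiantsHypothesis.ValiantsHypothesis.Theorems.KPlusLogSqLaw
namespace StaticTridiagonalRealUnit

open Real Finset Polynomial
open Summit.ValiantsHypothesis.ValiantsHypothesis.Theorems.KPlusLogSqLaw.StaticTridiagonalRealPotential
  (pathDet pathDet_zero pathDet_one pathDet_add_two)

variable (d : ℕ → ℕ) (f : ℕ → ℕ)

/-! ### 1. The differentiated recurrence -/

/-- `D'_0 = 0` and `x·D'_1 = d_0 x^{d_0}`. [this file] -/
theorem x_mul_eval_derivative_zero_one (x : ℝ) :
    x * (derivative (pathDet (fun _ => (1 : ℝ)) d (fun _ => (1 : ℝ)) f 0)).eval x = 0 ∧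
      x * (derivative (pathDet (fun _ => (1 : ℝ)) d (fun _ => (1 : ℝ)) f 1)).eval x = (d 0 : ℝ) * x ^ d 0 := by
  rw [pathDet_zero, pathDet_one, C_1, one_mul, derivative_one, derivative_X_pow]
  simp only [eval_zero, mul_zero, eval_mul, eval_C, eval_pow, eval_X, true_and]
  exact Summit.ValiantsHypothesis.ValiantsHypothesis.Theorems.LacunarySymmetroidMatrixDescartes.SecularRolle.mul_natCast_mul_pow_pred x (d 0)

/-- **differentiated recurrence**: `x·D'_{n+2} = d_{n+1}x^{d_{n+1}}D_{n+1} + x^{d_{n+1}}·(xD'_{n+1}) − 2f_n x^{2f_n}D_n − x^{2f_n}·(xD'_n)`. [this file] -/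
theorem x_mul_eval_derivative_add_two (x : ℝ) (n : ℕ) :
    x * (derivative (pathDet (fun _ => (1 : ℝ)) d (fun _ => (1 : ℝ)) f (n + 2))).eval x =
      (d (n + 1) : ℝ) * x ^ d (n + 1) * (pathDet (fun _ => (1 : ℝ)) d (fun _ => (1 : ℝ)) f (n + 1)).eval x +
        x ^ d (n + 1) * (x * (derivative (pathDet (fun _ => (1 : ℝ)) d (fun _ => (1 : ℝ)) f (n + 1))).eval x) -
        (2 * (f n : ℝ)) * x ^ (2 * f n) * (pathDet (fun _ => (1 : ℝ)) d (fun _ => (1 : ℝ)) f n).eval x -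
        x ^ (2 * f n) * (x * (derivative (pathDet (fun _ => (1 : ℝ)) d (fun _ => (1 : ℝ)) f n)).eval x) := by
  rw [pathDet_add_two, C_1, one_mul, one_mul, ← pow_mul, mul_comm (f n) 2, derivative_sub, derivative_mul, derivative_mul,
    derivative_X_pow, derivative_X_pow]
  simp only [eval_sub, eval_add, eval_mul, eval_C, eval_pow, eval_X]
  have h1 := Summit.ValiantsHypothesis.ValiantsHypothesis.Theorems.LacunarySymmetroidMatrixDescartes.SecularRolle.mul_natCast_mul_pow_pred x (d (n + 1))
  have h2 := Summit.ValiantsHypothesis.ValiantsHypothesis.Theorems.LacunarySymmetroidMatrixDescartes.SecularRolle.mul_natCast_mul_pow_pred x (2 * f n)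
  push_cast at h2 ⊢
  linear_combination ((pathDet (fun _ => (1 : ℝ)) d (fun _ => (1 : ℝ)) f (n + 1)).eval x) * h1 -
    ((pathDet (fun _ => (1 : ℝ)) d (fun _ => (1 : ℝ)) f n).eval x) * h2

/-! ### 2. The Wronskian identity -/

/-- **WRONSKIAN IDENTITY (all sizes)**: for every `n` and `x > 0`,
`x·(D_n D'_{n+1} − D'_n D_{n+1})(x) / x^{2F_n} = Σ_{i≤n} d_i μ_i − 2·Σ_{k<n} f_k e_k` (Abel's identity for the continuant recurrence). [this file] -/
theorem wronskian_eq (x : ℝ) (hx : 0 < x) (n : ℕ) :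
    x * ((pathDet (fun _ => (1 : ℝ)) d (fun _ => (1 : ℝ)) f n).eval x *
          (derivative (pathDet (fun _ => (1 : ℝ)) d (fun _ => (1 : ℝ)) f (n + 1))).eval x -
        (derivative (pathDet (fun _ => (1 : ℝ)) d (fun _ => (1 : ℝ)) f n)).eval x *
          (pathDet (fun _ => (1 : ℝ)) d (fun _ => (1 : ℝ)) f (n + 1)).eval x) / x ^ (2 * ∑ j ∈ range n, f j) =
      ∑ i ∈ range (n + 1), (d i : ℝ) * (x ^ d i * (pathDet (fun _ => (1 : ℝ)) d (fun _ => (1 : ℝ)) f i).eval x ^ 2 /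
          x ^ (2 * ∑ j ∈ range i, f j)) -
        2 * ∑ k ∈ range n, (f k : ℝ) * ((pathDet (fun _ => (1 : ℝ)) d (fun _ => (1 : ℝ)) f k).eval x *
          (pathDet (fun _ => (1 : ℝ)) d (fun _ => (1 : ℝ)) f (k + 1)).eval x / x ^ (2 * ∑ j ∈ range k, f j)) := by
  induction n with
  | zero =>
    obtain ⟨h0, h1⟩ := x_mul_eval_derivative_zero_one d f x
    obtain ⟨e0, e1⟩ := eval_unit_zero_one d f x
    simp only [sum_range_zero, sum_range_one, mul_zero, pow_zero, div_one, zero_add, sub_zero, e0]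
    have : (derivative (pathDet (fun _ => (1 : ℝ)) d (fun _ => (1 : ℝ)) f 0)).eval x = 0 := by
      rw [pathDet_zero, derivative_one, eval_zero]
    rw [this, zero_mul, sub_zero, one_mul, h1, one_pow, mul_one]
  | succ n ih =>
    have hrec := eval_unit_add_two d f x n
    have hder := x_mul_eval_derivative_add_two d f x n
    -- the numerator recursion (Abel's step)
    have keym : x * ((pathDet (fun _ => (1 : ℝ)) d (fun _ => (1 : ℝ)) f (n + 1)).eval x *
          (derivative (pathDet (fun _ => (1 : ℝ)) d (fun _ => (1 : ℝ)) f (n + 2))).eval x -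
        (derivative (pathDet (fun _ => (1 : ℝ)) d (fun _ => (1 : ℝ)) f (n + 1))).eval x *
          (pathDet (fun _ => (1 : ℝ)) d (fun _ => (1 : ℝ)) f (n + 2)).eval x) =
        x ^ (2 * f n) * (x * ((pathDet (fun _ => (1 : ℝ)) d (fun _ => (1 : ℝ)) f n).eval x *
          (derivative (pathDet (fun _ => (1 : ℝ)) d (fun _ => (1 : ℝ)) f (n + 1))).eval x -
        (derivative (pathDet (fun _ => (1 : ℝ)) d (fun _ => (1 : ℝ)) f n)).eval x *
          (pathDet (fun _ => (1 : ℝ)) d (fun _ => (1 : ℝ)) f (n + 1)).eval x)) +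
        ((d (n + 1) : ℝ) * x ^ d (n + 1) * (pathDet (fun _ => (1 : ℝ)) d (fun _ => (1 : ℝ)) f (n + 1)).eval x ^ 2 -
          2 * (f n : ℝ) * x ^ (2 * f n) * ((pathDet (fun _ => (1 : ℝ)) d (fun _ => (1 : ℝ)) f n).eval x *
            (pathDet (fun _ => (1 : ℝ)) d (fun _ => (1 : ℝ)) f (n + 1)).eval x)) := by
      rw [hrec]
      linear_combination ((pathDet (fun _ => (1 : ℝ)) d (fun _ => (1 : ℝ)) f (n + 1)).eval x) * hder
    rw [show n + 1 + 1 = n + 2 by omega, sum_range_succ (fun i => (d i : ℝ) * _) (n + 1), sum_range_succ (fun k => (f k : ℝ) * _) n,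
      keym]
    set A := ∑ i ∈ range (n + 1), (d i : ℝ) * (x ^ d i * (pathDet (fun _ => (1 : ℝ)) d (fun _ => (1 : ℝ)) f i).eval x ^ 2 /
          x ^ (2 * ∑ j ∈ range i, f j)) with hA
    set B := ∑ k ∈ range n, (f k : ℝ) * ((pathDet (fun _ => (1 : ℝ)) d (fun _ => (1 : ℝ)) f k).eval x *
          (pathDet (fun _ => (1 : ℝ)) d (fun _ => (1 : ℝ)) f (k + 1)).eval x / x ^ (2 * ∑ j ∈ range k, f j)) with hB
    have hx1 : x ^ (2 * ∑ j ∈ range n, f j) ≠ 0 := pow_ne_zero _ hx.ne'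
    have hx2 : x ^ (2 * f n) ≠ 0 := pow_ne_zero _ hx.ne'
    have ih' : x * ((pathDet (fun _ => (1 : ℝ)) d (fun _ => (1 : ℝ)) f n).eval x *
          (derivative (pathDet (fun _ => (1 : ℝ)) d (fun _ => (1 : ℝ)) f (n + 1))).eval x -
        (derivative (pathDet (fun _ => (1 : ℝ)) d (fun _ => (1 : ℝ)) f n)).eval x *
          (pathDet (fun _ => (1 : ℝ)) d (fun _ => (1 : ℝ)) f (n + 1)).eval x) = (A - 2 * B) * x ^ (2 * ∑ j ∈ range n, f j) := by
      rw [← ih, div_mul_cancel₀ _ hx1]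
    rw [ih', sum_range_succ, mul_add, pow_add]
    field_simp
    ring

/-! ### 3. The Jacobi step and the derivative-sign law -/

/-- **JACOBI STEP (all sizes)**: at a zero `x > 0` of `D_m`, `m = n + 2`:
`x·D_{m−1}(x)·D'_m(x) / x^{2F_{m−1}} = −Σ_{k<m−1} (2f_k − d_k − d_{k+1})·D_kD_{k+1}x^{−2F_k}`. [this file] -/
theorem deriv_mul_prev_eq_neg_slopeEnergy (n : ℕ) (x : ℝ) (hx : 0 < x)
    (hroot : (pathDet (fun _ => (1 : ℝ)) d (fun _ => (1 : ℝ)) f (n + 2)).eval x = 0) :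
    x * ((pathDet (fun _ => (1 : ℝ)) d (fun _ => (1 : ℝ)) f (n + 1)).eval x *
        (derivative (pathDet (fun _ => (1 : ℝ)) d (fun _ => (1 : ℝ)) f (n + 2))).eval x) / x ^ (2 * ∑ j ∈ range (n + 1), f j) =
      -∑ k ∈ range (n + 1), ((2 * (f k : ℝ)) - ((d k + d (k + 1) : ℕ) : ℝ)) *
        ((pathDet (fun _ => (1 : ℝ)) d (fun _ => (1 : ℝ)) f k).eval x * (pathDet (fun _ => (1 : ℝ)) d (fun _ => (1 : ℝ)) f (k + 1)).eval x /
          x ^ (2 * ∑ j ∈ range k, f j)) := by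
  have hW := wronskian_eq d f x hx (n + 1)
  rw [show n + 1 + 1 = n + 2 by omega, hroot, mul_zero, sub_zero] at hW
  have hQ := quadForm_eq_neg_slopeEnergy d f n x hx hroot
  have hM : ∑ i ∈ range (n + 2), (d i : ℝ) * (x ^ d i *
      ((-1) ^ i * (pathDet (fun _ => (1 : ℝ)) d (fun _ => (1 : ℝ)) f i).eval x / x ^ (∑ j ∈ range i, f j)) ^ 2) =
      ∑ i ∈ range (n + 2), (d i : ℝ) * (x ^ d i * (pathDet (fun _ => (1 : ℝ)) d (fun _ => (1 : ℝ)) f i).eval x ^ 2 /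
        x ^ (2 * ∑ j ∈ range i, f j)) := sum_congr rfl fun i _ => by rw [mass_eq]
  have hL : ∑ k ∈ range (n + 1), (f k : ℝ) * (x ^ f k *
      ((-1) ^ k * (pathDet (fun _ => (1 : ℝ)) d (fun _ => (1 : ℝ)) f k).eval x / x ^ (∑ j ∈ range k, f j)) *
      ((-1) ^ (k + 1) * (pathDet (fun _ => (1 : ℝ)) d (fun _ => (1 : ℝ)) f (k + 1)).eval x / x ^ (∑ j ∈ range (k + 1), f j))) =
      -∑ k ∈ range (n + 1), (f k : ℝ) * ((pathDet (fun _ => (1 : ℝ)) d (fun _ => (1 : ℝ)) f k).eval x *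
        (pathDet (fun _ => (1 : ℝ)) d (fun _ => (1 : ℝ)) f (k + 1)).eval x / x ^ (2 * ∑ j ∈ range k, f j)) := by
    rw [← sum_neg_distrib]
    exact sum_congr rfl fun k _ => by rw [link_eq d f x hx k]; ring
  rw [hM, hL] at hQ
  rw [hW]
  linarith

/-- **DERIVATIVE-SIGN LAW below the resonance (all sizes)**: `0 < x < 1`, all slopes positive, `x` a zero of `D_m` (`m ≥ 3`) with `D_1, …, D_{m−1}`
nonzero and no two negative pivot products three edges apart ⇒ `D'_m(x)·D_{m−1}(x) < 0`; in particular the zero is simple. [this file] -/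
theorem deriv_mul_prev_neg_below_one (m : ℕ) (hm : 3 ≤ m) (x : ℝ) (hx : 0 < x) (hx1 : x < 1)
    (hslope : ∀ k, k + 1 < m → d k + d (k + 1) < 2 * f k)
    (hroot : (pathDet (fun _ => (1 : ℝ)) d (fun _ => (1 : ℝ)) f m).eval x = 0)
    (hnd : ∀ k, 0 < k → k < m → (pathDet (fun _ => (1 : ℝ)) d (fun _ => (1 : ℝ)) f k).eval x ≠ 0)
    (hsep : ∀ k, k + 4 < m →
      (pathDet (fun _ => (1 : ℝ)) d (fun _ => (1 : ℝ)) f k).eval x * (pathDet (fun _ => (1 : ℝ)) d (fun _ => (1 : ℝ)) f (k + 1)).eval x < 0 →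
      0 < (pathDet (fun _ => (1 : ℝ)) d (fun _ => (1 : ℝ)) f (k + 3)).eval x * (pathDet (fun _ => (1 : ℝ)) d (fun _ => (1 : ℝ)) f (k + 4)).eval x) :
    (derivative (pathDet (fun _ => (1 : ℝ)) d (fun _ => (1 : ℝ)) f m)).eval x *
      (pathDet (fun _ => (1 : ℝ)) d (fun _ => (1 : ℝ)) f (m - 1)).eval x < 0 := by
  have hpos := slopeEnergy_pos_below_one d f m hm x hx hx1 hslope hroot hnd hsep
  obtain ⟨n, rfl⟩ : ∃ n, m = n + 2 := ⟨m - 2, by omega⟩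
  rw [show n + 2 - 1 = n + 1 by omega] at hpos ⊢
  have hJ := deriv_mul_prev_eq_neg_slopeEnergy d f n x hx hroot
  have hneg : x * ((pathDet (fun _ => (1 : ℝ)) d (fun _ => (1 : ℝ)) f (n + 1)).eval x *
      (derivative (pathDet (fun _ => (1 : ℝ)) d (fun _ => (1 : ℝ)) f (n + 2))).eval x) / x ^ (2 * ∑ j ∈ range (n + 1), f j) < 0 := by
    rw [hJ]; linarith
  have hxF : 0 < x ^ (2 * ∑ j ∈ range (n + 1), f j) := pow_pos hx _
  have h1 : x * ((pathDet (fun _ => (1 : ℝ)) d (fun _ => (1 : ℝ)) f (n + 1)).eval x *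
      (derivative (pathDet (fun _ => (1 : ℝ)) d (fun _ => (1 : ℝ)) f (n + 2))).eval x) < 0 := by
    rcases lt_or_ge (x * ((pathDet (fun _ => (1 : ℝ)) d (fun _ => (1 : ℝ)) f (n + 1)).eval x *
      (derivative (pathDet (fun _ => (1 : ℝ)) d (fun _ => (1 : ℝ)) f (n + 2))).eval x)) 0 with h | h
    · exact h
    · exact absurd hneg (not_lt.2 (div_nonneg h hxF.le))
  rw [mul_comm]
  exact (pos_iff_pos_of_mul_pos (show 0 < x * -((pathDet (fun _ => (1 : ℝ)) d (fun _ => (1 : ℝ)) f (n + 1)).eval x *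
      (derivative (pathDet (fun _ => (1 : ℝ)) d (fun _ => (1 : ℝ)) f (n + 2))).eval x) by linarith)).1 hx |> fun h => by linarith

/-- **DERIVATIVE-SIGN LAW above the resonance (all sizes)**: `x > 1`, all slopes negative, same hypotheses ⇒ `D'_m(x)·D_{m−1}(x) > 0`. [this file] -/
theorem deriv_mul_prev_pos_above_one (m : ℕ) (hm : 3 ≤ m) (x : ℝ) (hx1 : 1 < x)
    (hslope : ∀ k, k + 1 < m → 2 * f k < d k + d (k + 1))
    (hroot : (pathDet (fun _ => (1 : ℝ)) d (fun _ => (1 : ℝ)) f m).eval x = 0)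
    (hnd : ∀ k, 0 < k → k < m → (pathDet (fun _ => (1 : ℝ)) d (fun _ => (1 : ℝ)) f k).eval x ≠ 0)
    (hsep : ∀ k, k + 4 < m →
      (pathDet (fun _ => (1 : ℝ)) d (fun _ => (1 : ℝ)) f k).eval x * (pathDet (fun _ => (1 : ℝ)) d (fun _ => (1 : ℝ)) f (k + 1)).eval x < 0 →
      0 < (pathDet (fun _ => (1 : ℝ)) d (fun _ => (1 : ℝ)) f (k + 3)).eval x * (pathDet (fun _ => (1 : ℝ)) d (fun _ => (1 : ℝ)) f (k + 4)).eval x) :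
    0 < (derivative (pathDet (fun _ => (1 : ℝ)) d (fun _ => (1 : ℝ)) f m)).eval x *
      (pathDet (fun _ => (1 : ℝ)) d (fun _ => (1 : ℝ)) f (m - 1)).eval x := by
  have hx : 0 < x := one_pos.trans hx1
  have hneg' := slopeEnergy_neg_above_one d f m hm x hx1 hslope hroot hnd hsep
  obtain ⟨n, rfl⟩ : ∃ n, m = n + 2 := ⟨m - 2, by omega⟩
  rw [show n + 2 - 1 = n + 1 by omega] at hneg' ⊢
  have hJ := deriv_mul_prev_eq_neg_slopeEnergy d f n x hx hroot
  have hposq : 0 < x * ((pathDet (fun _ => (1 : ℝ)) d (fun _ => (1 : ℝ)) f (n + 1)).eval x *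
      (derivative (pathDet (fun _ => (1 : ℝ)) d (fun _ => (1 : ℝ)) f (n + 2))).eval x) / x ^ (2 * ∑ j ∈ range (n + 1), f j) := by
    rw [hJ]; linarith
  have h1 := (pos_iff_pos_of_mul_pos (div_pos_iff.1 hposq |>.elim (fun h => h.1) (fun h => absurd h.2 (not_lt.2 (pow_pos hx _).le)))).1 hx
  rw [mul_comm]; exact h1

/-- **DERIVATIVE-SIGN LAW, `m ≤ 8`, no separation hypothesis**: below the resonance with all slopes positive, at EVERY nondegenerate zero
`D'_m(x)·D_{m−1}(x) < 0` (so every such zero is simple and crossed towards one more negative eigenvalue). [this file] -/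
theorem deriv_mul_prev_neg_below_one_of_le_eight (m : ℕ) (hm : 3 ≤ m) (hm8 : m ≤ 8) (x : ℝ) (hx : 0 < x) (hx1 : x < 1)
    (hslope : ∀ k, k + 1 < m → d k + d (k + 1) < 2 * f k)
    (hroot : (pathDet (fun _ => (1 : ℝ)) d (fun _ => (1 : ℝ)) f m).eval x = 0)
    (hnd : ∀ k, 0 < k → k < m → (pathDet (fun _ => (1 : ℝ)) d (fun _ => (1 : ℝ)) f k).eval x ≠ 0) :
    (derivative (pathDet (fun _ => (1 : ℝ)) d (fun _ => (1 : ℝ)) f m)).eval x *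
      (pathDet (fun _ => (1 : ℝ)) d (fun _ => (1 : ℝ)) f (m - 1)).eval x < 0 := by
  have hbal := slopeEnergy_balance_pos_of_le_eight d f m hm hm8 x hx
    (fun k hk => pow_lt_pow_right_of_lt_one₀ hx hx1 (hslope k hk)) hroot hnd
  obtain ⟨n, rfl⟩ : ∃ n, m = n + 2 := ⟨m - 2, by omega⟩
  rw [show n + 2 - 1 = n + 1 by omega] at hbal ⊢
  have hlog : log x < 0 := log_neg hx hx1
  have hJ := deriv_mul_prev_eq_neg_slopeEnergy d f n x hx hroot
  -- the balance is `(−log x)·(slope energy)`; combine with the Jacobi step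
  have hrw : ∑ k ∈ range (n + 1), (((d k + d (k + 1) : ℕ) : ℝ) - 2 * (f k : ℝ)) * log x *
      ((pathDet (fun _ => (1 : ℝ)) d (fun _ => (1 : ℝ)) f k).eval x * (pathDet (fun _ => (1 : ℝ)) d (fun _ => (1 : ℝ)) f (k + 1)).eval x /
        x ^ (2 * ∑ j ∈ range k, f j)) =
      log x * (x * ((pathDet (fun _ => (1 : ℝ)) d (fun _ => (1 : ℝ)) f (n + 1)).eval x *
        (derivative (pathDet (fun _ => (1 : ℝ)) d (fun _ => (1 : ℝ)) f (n + 2))).eval x) / x ^ (2 * ∑ j ∈ range (n + 1), f j)) := by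
    rw [hJ, mul_neg, mul_sum, ← sum_neg_distrib]
    exact sum_congr rfl fun k _ => by ring
  rw [hrw] at hbal
  have hq : x * ((pathDet (fun _ => (1 : ℝ)) d (fun _ => (1 : ℝ)) f (n + 1)).eval x *
      (derivative (pathDet (fun _ => (1 : ℝ)) d (fun _ => (1 : ℝ)) f (n + 2))).eval x) / x ^ (2 * ∑ j ∈ range (n + 1), f j) < 0 := by
    rcases lt_or_ge (x * ((pathDet (fun _ => (1 : ℝ)) d (fun _ => (1 : ℝ)) f (n + 1)).eval x *
      (derivative (pathDet (fun _ => (1 : ℝ)) d (fun _ => (1 : ℝ)) f (n + 2))).eval x) / x ^ (2 * ∑ j ∈ range (n + 1), f j)) 0 with h | h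
    · exact h
    · exact absurd hbal (not_lt.2 (mul_nonpos_of_nonpos_of_nonneg hlog.le h))
  have hxF : 0 < x ^ (2 * ∑ j ∈ range (n + 1), f j) := pow_pos hx _
  have h1 : x * ((pathDet (fun _ => (1 : ℝ)) d (fun _ => (1 : ℝ)) f (n + 1)).eval x *
      (derivative (pathDet (fun _ => (1 : ℝ)) d (fun _ => (1 : ℝ)) f (n + 2))).eval x) < 0 := by
    rcases lt_or_ge (x * ((pathDet (fun _ => (1 : ℝ)) d (fun _ => (1 : ℝ)) f (n + 1)).eval x *
      (derivative (pathDet (fun _ => (1 : ℝ)) d (fun _ => (1 : ℝ)) f (n + 2))).eval x)) 0 with h | h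
    · exact h
    · exact absurd hq (not_lt.2 (div_nonneg h hxF.le))
  rw [mul_comm]
  exact (pos_iff_pos_of_mul_pos (show 0 < x * -((pathDet (fun _ => (1 : ℝ)) d (fun _ => (1 : ℝ)) f (n + 1)).eval x *
      (derivative (pathDet (fun _ => (1 : ℝ)) d (fun _ => (1 : ℝ)) f (n + 2))).eval x) by linarith)).1 hx |> fun h => by linarith

end StaticTridiagonalRealUnit
end Summit.ValiantsHypothesis.ValiantsHypothesis.Theorems.KPlusLogSqLaw
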